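import Summits.CriticalPhenomena.CardyFormulaZ2.Theorems.CardyComplexConeParafermionToSLESixFamiliesDiamondCollar
import Summits.CriticalPhenomena.CardyFormulaZ2.Theorems.CardyComplexConeParafermionToSLESixFamiliesDiamondClosedClass
import Summits.CriticalPhenomena.CardyFormulaZ2.Theorems.CardyComplexConeParafermionToSLESixFamiliesDiamondFreeTouchLower
import Summits.CriticalPhenomena.CardyFormulaZ2.Theorems.CardyComplexConeParafermionToSLESixFamiliesDiamondPotentialConformalLimit
import Summits.CriticalPhenomena.CardyFormulaZ2.Theorems.CardyComplexConeParafermionToSLESixFamiliesDiamondIdentifyAssembly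
import Summits.CriticalPhenomena.CardyFormulaZ2.Theorems.CardyComplexConeParafermionToSLESixFamiliesFlipDiagArmLowerOfIkhlefPonsaing
import HarnessLib

/-!
# Vocabulary of line `potential-darboux-picard-diamond`, part 5 (reshape r6): the continuity-guarded collar statement and N + I on marked
# diamonds from the three external inputs — crux `ParafermionToSLESixFamilies` (stmt-CriticalPhenomena-11389)

Lead c5, after wave 5 (2026-08-17). Wave 5 landed the conditional derivations of the three conjuncts of S3 from inputs EXTERNAL to the crux:
`collar_of_uniformInnerEnvelope : UniformInnerEnvelope → ClosedCollar` (p165486), `freeTouchLower_of_diagArmLower : DiagHalfPlaneOneArmLower →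
FreeTouchLower` (p168828), and — for the class conjunct — `closedClass_continuous_of_edgeCoherence` (p165722): (b′) holds from `EdgeCoherence` ALONE,
but only in its CONTINUITY-GUARDED form; the unguarded `ClosedClass` (and with it conjunct (b′) of the planner's `ClosedPrecompactness`) is too
strong as typed (`IsPotentialLimit` sees `G` only at the countable set of cell centres; `not_isPotentialLimit_of_closedClass`, p165722). Hence:

* `ClosedClassC`, `ClosedPrecompactnessC` — the guarded statements (S3′ of skeleton r6 is `stub_closedPrecompactnessC : ClosedPrecompactnessC`);
* `closedPrecompactnessC_of_parts`, `closedPrecompactnessC_of_closedPrecompactness` (the reshape WEAKENS S3), `closedClassC_of_edgeCoherence`;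
* **`closedPrecompactnessC_of_inputs : UniformInnerEnvelope → EdgeCoherence → DiagHalfPlaneOneArmLower → ClosedPrecompactnessC`** — S3′ from the
  three named external inputs (11387's X1, route item stmt-11385, N), kernel-checked;
* `potentialConformalLimit_of_identifyC` — the landed assembly re-run with the guarded hypothesis (one token), whence
  `identifyPotentialPhC`, `potentialConformalLimit_of_closedPrecompactnessC` and the line's headline
  **`potentialConformalLimit_of_inputs : UniformInnerEnvelope → EdgeCoherence → DiagHalfPlaneOneArmLower → PotentialConformalLimit`** (and
  `…_of_ikhlefPonsaing` with `IkhlefPonsaingFirstPassage` in place of N): non-degeneracy + conformal identification of the potential limit on every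
  marked diamond (DCS Conj. 8.7, integrated family form, diamonds) from X1 + #2 + IP12 — the crux's own hypotheses A, B unused.
-/

noncomputable section

namespace Summit.CriticalPhenomena.CardyFormulaZ2.Cruxes.ParafermionToSLESixFamilies.PotentialDarbouxPicardDiamond


open scoped Topology ComplexConjugate BigOperators
open Filter Set Metric Complex
open UpperHalfPlane (upperHalfPlaneSet)
open Literature.Probability Literature.Probability.LatticeModels Literature.Probability.Percolation
open Literature.Probability.RandomPlanarGeometry
open Summit.CriticalPhenomena.CardyFormulaZ2.Cruxes.ParafermionToSLESixFamilies.IicTraceFluxPairing (IsFamily)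

/-- **S3 (b′) guarded — THE CLASS STRUCTURE OF CONTINUOUS LIMITS**: every subsequential compact-uniform potential limit `G` which is CONTINUOUS on
the carrier is holomorphic or antiholomorphic there (`ClosedClass` with the guard `ContinuousOn G D.carrier`; the unguarded form is refuted modulo
existence of a potential limit, `not_isPotentialLimit_of_closedClass`). -/
def ClosedClassC : Prop :=
  ∀ (D : DobrushinDomain), IsMarkedDiamond D → ∀ (Λ : ℝ → DiscreteDobrushin), IsFamily D Λ →
    ∀ u : ℕ → ℝ, (∀ k, 0 < u k) → Tendsto u atTop (𝓝 0) → ∀ G : ℂ → ℂ, ContinuousOn G D.carrier → IsPotentialLimit D Λ u G →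
      DifferentiableOn ℂ G D.carrier ∨ DifferentiableOn ℂ (fun z => (starRingEnd ℂ) (G z)) D.carrier

/-- **S3′ — THE GUARDED COLLAR / CLASS / NON-DEGENERACY STATEMENT** (`ClosedPrecompactness` verbatim except that conjunct (b′) carries the guard
`ContinuousOn G D.carrier →`). -/
def ClosedPrecompactnessC : Prop :=
  ∀ (D : DobrushinDomain), IsMarkedDiamond D → ∀ (Λ : ℝ → DiscreteDobrushin), IsFamily D Λ →
    (∀ ε > (0:ℝ), ∃ η > (0:ℝ), ∀ᶠ δ in 𝓝[>] (0:ℝ), ∀ Φ Ψ : Site 2 → ℂ, IsExactPair (Λ δ) δ Φ Ψ →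
      ∀ f f' : Site 2, IsCell (Λ δ) f → IsCell (Λ δ) f' → dist (ctr δ f) (ctr δ f') < η →
        ‖(((δ ^ ((2:ℝ) / 3) : ℝ) : ℂ)) * (Ψ f - Ψ f')‖ ≤ ε) ∧
    (∀ u : ℕ → ℝ, (∀ k, 0 < u k) → Tendsto u atTop (𝓝 0) → ∀ G : ℂ → ℂ, ContinuousOn G D.carrier → IsPotentialLimit D Λ u G →
      DifferentiableOn ℂ G D.carrier ∨ DifferentiableOn ℂ (fun z => (starRingEnd ℂ) (G z)) D.carrier) ∧
    (∃ (p q : ℂ) (c₀ : ℝ), IsBdrySegment D p q ∧ segment ℝ p q ⊆ D.arc 1 ∧ 0 < c₀ ∧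
      ∀ᶠ δ in 𝓝[>] (0:ℝ), c₀ ≤ touchMass (Λ δ) δ p q (‖q - p‖ / 4) (3 * ‖q - p‖ / 4))

/-- Glue: the three conjuncts (collar, guarded class, non-degeneracy) give S3′. -/
theorem closedPrecompactnessC_of_parts : ClosedCollar → ClosedClassC → FreeTouchLower → ClosedPrecompactnessC :=
  fun ha hb hc D hD Λ hΛ => ⟨ha D hD Λ hΛ, hb D hD Λ hΛ, hc D hD Λ hΛ⟩

/-- The reshape only WEAKENS S3: `ClosedPrecompactness → ClosedPrecompactnessC`. -/
theorem closedPrecompactnessC_of_closedPrecompactness : ClosedPrecompactness → ClosedPrecompactnessC :=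
  fun h D hD Λ hΛ => ⟨(h D hD Λ hΛ).1, fun u hu hu0 G _ hG => (h D hD Λ hΛ).2.1 u hu hu0 G hG, (h D hD Λ hΛ).2.2⟩

/-- (b′) guarded from `EdgeCoherence` alone (the landed `closedClass_continuous_of_edgeCoherence`, p165722). -/
theorem closedClassC_of_edgeCoherence : Summit.CriticalPhenomena.CardyFormulaZ2.Theses.CardyComplexCone.EdgeCoherence → ClosedClassC :=
  fun h => closedClass_continuous_of_edgeCoherence h

/-- **S3′ from the three named external inputs** (11387's X1 `UniformInnerEnvelope`, route item #2 `EdgeCoherence`, the diagonal half-plane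
one-arm lower bound N): kernel-checked over p165486, p165722, p168828. -/
theorem closedPrecompactnessC_of_inputs :
    Summit.CriticalPhenomena.CardyFormulaZ2.Cruxes.EdgePrecompact.QkzStripBoundaryArm.UniformInnerEnvelope →
    Summit.CriticalPhenomena.CardyFormulaZ2.Theses.CardyComplexCone.EdgeCoherence →
    Summit.CriticalPhenomena.CardyFormulaZ2.Cruxes.ParafermionToSLESixFamilies.FlipInvolutionReturnLaw.DiagHalfPlaneOneArmLower →
    ClosedPrecompactnessC :=
  fun hX hE hN => closedPrecompactnessC_of_parts (collar_of_uniformInnerEnvelope hX) (closedClassC_of_edgeCoherence hE)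
    (freeTouchLower_of_diagArmLower hN)

/-- **The assembly with the continuity-guarded class hypothesis** (verbatim the landed `potentialConformalLimit_of_identify`, p144695,
with `ClosedPrecompactness` weakened to `ClosedPrecompactnessC`: the class conjunct is used only on the subsequential limit `G`, which is
continuous on the closed diamond, so the guard costs one token). -/
theorem potentialConformalLimit_of_identifyC : BoundaryIdentification → ExactPotentialTracePh → (DarbouxPicardConvex ∧ TraceWindingNonneg) → ClosedPrecompactnessC → PotentialConformalLimit := by
  intro hIdent hS1 hS2 hS3 D hD Λ hΛ u hu hu0
  obtain ⟨hDP, hTW⟩ := hS2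
  obtain ⟨hE, τ, uA, C, c₁, hc₁, huA, hτ1, hTURN, hDIR, hLOW⟩ := hS1 D hD Λ hΛ
  obtain ⟨hequi, hclass, p, q, c₀, hpq, hfree, hc₀, hmass⟩ := hS3 D hD Λ hΛ
  refine ⟨eventually_atTop_of_eventually_nhdsGT hu hu0 hE, ?_⟩
  -- Step (i): the subsequential limit on the closed diamond
  obtain ⟨s, P, zc, alim, G, hs, hP, halim1, halim, hGc, hunif, hPL, hall⟩ :=
    exists_subseq_potentialLimit D hD Λ hΛ hE hequi u hu hu0 (fun k => uA (u k)) fun k => huA _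
  set u' : ℕ → ℝ := fun k => u (s k) with hu'
  have hu'pos : ∀ k, 0 < u' k := fun k => hu _
  have hu'0 : Tendsto u' atTop (𝓝 0) := hu0.comp hs.tendsto_atTop
  have ha' : ∀ k, ‖uA (u' k)‖ = 1 := fun k => huA _
  have hGclass : DifferentiableOn ℂ G D.carrier ∨ DifferentiableOn ℂ (fun z => conj (G z)) D.carrier :=
    hclass u' hu'pos hu'0 G (hGc.mono subset_closure) hPL
  -- Step (ii′): DIR in the limit on every oriented boundary segment
  have htrace : ∀ p q : ℂ, IsBdrySegment D p q → ∀ z ∈ segment ℝ p q, ∀ z' ∈ segment ℝ p q,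
      proj p q z ≤ proj p q z' → ∃ r : ℝ, 0 ≤ r ∧ G z' - G z = r * (alim * τ p q) := fun p q hpq =>
    trace_sub_mem_ray D hD Λ hΛ (τ p q) uA C p q hpq (hDIR p q hpq) u' hu'pos hu'0 ha' P zc alim G hP halim hGc hunif
  -- Step (iii): the boundary chain and the directions
  obtain ⟨N, ℓ, t, c, hN4, hc, hconvD, hℓc, hper, hrange, hinj, ht0, htlt, htper, hseg, haff, harg, hargsum, hθcases,
    hθsum⟩ := exists_boundaryChain D hD
  have hN : 0 < N := by omega
  set θ : ℕ → ℝ := fun j => (2 / 3 : ℝ) * ((ℓ (t (j + 2)) - ℓ (t (j + 1))) / (ℓ (t (j + 1)) - ℓ (t j))).arg +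
    Real.pi / 3 * markInd D (ℓ (t (j + 1))) with hθdef
  set d : ℕ → ℂ := fun j => alim * τ (ℓ (t j)) (ℓ (t (j + 1))) with hddef
  have hd : ∀ j, d (j + 1) = d j * exp (θ j * I) := by
    intro j
    simp only [hddef, hθdef]
    rw [show j + 1 + 1 = j + 2 by ring, hTURN _ _ _ (hseg j) (by rw [show j + 2 = j + 1 + 1 by ring]; exact hseg (j + 1)),
      mul_assoc]
  have hd0 : ‖d 0‖ = 1 := by simp only [hddef]; rw [norm_mul, halim1, hτ1 _ _ (hseg 0), one_mul]
  have hd0ne : d 0 ≠ 0 := fun h => by rw [h, norm_zero] at hd0; exact zero_ne_one hd0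
  have hπ := Real.pi_pos
  have hθ : ∀ j, 0 < θ j ∧ θ j < Real.pi := by
    intro j
    rcases hθcases j with h | h
    · have : θ j = Real.pi / 3 := h
      rw [this]; constructor <;> linarith
    · have : θ j = 2 * Real.pi / 3 := h
      rw [this]; constructor <;> linarith
  have hvper : ∀ j, ℓ (t (j + N)) = ℓ (t j) := fun j => by rw [htper, hper]
  have hθper : ∀ j, θ (j + N) = θ j := by
    intro j
    simp only [hθdef]
    rw [show j + N + 2 = (j + 2) + N by ring, show j + N + 1 = (j + 1) + N by ring, hvper, hvper, hvper]
  have hθsum' : ∑ j ∈ Finset.range N, θ j = 2 * Real.pi := hθsum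
  -- monotonicity of `G` along `d j` on piece `j`
  have hne : ∀ j, ℓ (t j) ≠ ℓ (t (j + 1)) := fun j => (hseg j).1
  have hmono : ∀ (j : ℕ) (s s' : ℝ), t j ≤ s → s ≤ s' → s' ≤ t (j + 1) →
      ∃ r : ℝ, 0 ≤ r ∧ G (ℓ s') - G (ℓ s) = r * d j := by
    intro j s s' h1 h2 h3
    obtain ⟨hz, hprz⟩ := piece_point htlt haff hne h1 (h2.trans h3)
    obtain ⟨hz', hprz'⟩ := piece_point htlt haff hne (h1.trans h2) h3
    have hΔ : 0 < t (j + 1) - t j := by linarith [htlt j]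
    refine htrace _ _ (hseg j) _ hz _ hz' ?_
    rw [hprz, hprz']
    exact mul_le_mul_of_nonneg_right (div_le_div_of_nonneg_right (by linarith) hΔ.le) (norm_nonneg _)
  -- the limit polygon
  obtain ⟨hKc, hKconv, hKfr, hstrict, hdeg⟩ := boundaryTrace_polygon D N ℓ t G d θ hN hper hrange ht0 htlt htper hd0ne
    hd (fun j => ⟨(hθ j).1.le, (hθ j).2.le⟩) hθper hθsum' hmono
  set K := convexHull ℝ (Set.range fun j => G (ℓ (t j))) with hK
  -- the free side of positive length: `G` is not constant on the closed diamond
  have hlow := re_trace_ge_of_low D hD Λ hΛ (τ p q) uA C c₁ c₀ p q hpq hc₁.le (hLOW p q hpq hfree) hmass u' hu'pos hu'0 P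
    zc alim G hP halim hGc hunif
  set w : ℂ := p + ((1 / 8 : ℝ) : ℂ) * (q - p) with hw
  set w' : ℂ := p + ((7 / 8 : ℝ) : ℂ) * (q - p) with hw'
  have hwmem : ∀ r : ℝ, 0 ≤ r → r ≤ 1 → p + (r : ℂ) * (q - p) ∈ closure D.carrier := fun r hr0 hr1 =>
    frontier_subset_closure (hpq.2.1 (by
      rw [segment_eq_image' ℝ]; exact ⟨r, ⟨hr0, hr1⟩, by show p + r • (q - p) = _; rw [real_smul]⟩))
  have hGne : G w' ≠ G w := by
    intro heq
    have : c₁ * c₀ ≤ 0 := by simpa [heq] using hlow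
    nlinarith
  have hint : (interior K).Nonempty := by
    by_contra hempty
    rw [Set.not_nonempty_iff_eq_empty] at hempty
    exact hGne (hdeg hempty hGc hGclass w' (hwmem _ (by norm_num) (by norm_num)) w (hwmem _ (by norm_num) (by norm_num)))
  obtain ⟨w₀, hw₀⟩ := hint
  -- Step (iv): univalence onto `interior K`
  obtain ⟨hGhol, hGinj, hGim⟩ := conformal_of_boundaryTrace hDP hTW D N ℓ t c w₀ G d θ K hN hc hconvD hℓc hper hrange
    hinj ht0 htlt htper hseg haff harg hargsum hGc hGclass hd0ne hd (fun j => ⟨(hθ j).1.le, (hθ j).2⟩) hθsum' hmono hKc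
    hKconv hw₀ (fun z hz => (hKfr z hz).2) (hstrict w₀ hw₀)
  -- Step (v): the identification (hypothesis)
  obtain ⟨cst, hcst, hident⟩ := hIdent D hD N ℓ t G d K hN hℓc hper hrange hinj ht0 htlt htper hseg haff hd0 hd harg
    hargsum hθcases hθsum hGc hGhol hGinj hK hKc hKconv ⟨w₀, hw₀⟩ hGim (fun z hz => (hKfr z hz).2) hmono
  exact ⟨s, cst, G, hs, hcst, hGhol, hGc, hident, hall⟩

/-- **The engine over the guarded S3′**: `ExactPotentialTracePh → (DarbouxPicardConvex ∧ TraceWindingNonneg) → ClosedPrecompactnessC →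
PotentialConformalLimit` (the guarded assembly fed with the landed S4v `stub_boundaryIdentification`). -/
theorem identifyPotentialPhC :
    ExactPotentialTracePh → (DarbouxPicardConvex ∧ TraceWindingNonneg) → ClosedPrecompactnessC → PotentialConformalLimit :=
  potentialConformalLimit_of_identifyC stub_boundaryIdentification

/-- **N + I on marked diamonds from S3′ alone** (S1 `exactPotentialTracePh_holds`, S2 `stub_argumentPrinciple` proved). -/
theorem potentialConformalLimit_of_closedPrecompactnessC : ClosedPrecompactnessC → PotentialConformalLimit :=
  identifyPotentialPhC exactPotentialTracePh_holds stub_argumentPrinciple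

/-- **THE LINE'S HEADLINE: N + I on marked diamonds from the three named external inputs.** Along every admissible family of every marked
diamond, every mesh sequence has a subsequence along which the renormalised exact potential `δ^{2/3}Ψ` converges, uniformly on the closed
diamond and modulo constants, to a conformal map `G` with `(G′)³ = c·ψ′/ψ` (`c ≠ 0`, every chordal uniformizer) — GIVEN 11387's milestone X1
(`UniformInnerEnvelope`), route item #2 (`EdgeCoherence`, stmt-11385) and the diagonal half-plane one-arm lower bound N. -/
theorem potentialConformalLimit_of_inputs :
    Summit.CriticalPhenomena.CardyFormulaZ2.Cruxes.EdgePrecompact.QkzStripBoundaryArm.UniformInnerEnvelope →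
    Summit.CriticalPhenomena.CardyFormulaZ2.Theses.CardyComplexCone.EdgeCoherence →
    Summit.CriticalPhenomena.CardyFormulaZ2.Cruxes.ParafermionToSLESixFamilies.FlipInvolutionReturnLaw.DiagHalfPlaneOneArmLower →
    PotentialConformalLimit :=
  fun hX hE hN => potentialConformalLimit_of_closedPrecompactnessC (closedPrecompactnessC_of_inputs hX hE hN)

/-- The same with the PUBLISHED source of N: `IkhlefPonsaingFirstPassage` (Ikhlef–Ponsaing 2012, Prop. 4.7; unproved named fact of the tree)
in place of `DiagHalfPlaneOneArmLower`, through the landed glue `diagArmLower_of_ikhlefPonsaing` (p134439). -/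
theorem potentialConformalLimit_of_ikhlefPonsaing :
    Summit.CriticalPhenomena.CardyFormulaZ2.Cruxes.EdgePrecompact.QkzStripBoundaryArm.UniformInnerEnvelope →
    Summit.CriticalPhenomena.CardyFormulaZ2.Theses.CardyComplexCone.EdgeCoherence →
    Literature.Probability.Percolation.IkhlefPonsaingFirstPassage → PotentialConformalLimit :=
  fun hX hE hIP => potentialConformalLimit_of_inputs hX hE (FlipInvolutionReturnLaw.diagArmLower_of_ikhlefPonsaing hIP)

end Summit.CriticalPhenomena.CardyFormulaZ2.Cruxes.ParafermionToSLESixFamilies.PotentialDarbouxPicardDiamond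

end
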